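import Literature.Geometry.Lorentzian.KerrSchildMultiplierCurrent
import Literature.Geometry.Lorentzian.MinkowskiRadialMultiplier
import Literature.Geometry.Lorentzian.KerrSchildDivergence
import Literature.Geometry.Lorentzian.KerrRpBulk
import Summits.FinalStateConjecture.FinalStateConjecture.Theorems.ClusterCompletenessAdiabaticMultiKerrILEDZonePumping
import Summits.FinalStateConjecture.FinalStateConjecture.Theorems.ClusterCompletenessAdiabaticMultiKerrILEDTailsCutStationary
import Summits.FinalStateConjecture.FinalStateConjecture.Theorems.ClusterCompletenessAdiabaticMultiKerrILEDWeightedTCurrent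

/-!
# Crux `AdiabaticMultiKerrILED` (line `Sketch`) — the bulk of the radial Morawetz multiplier
# `X = F(r) ∂_{r*}` on the rest-frame tails-cut Schwarzschild zone

Helper file for the crux `stmt-FinalStateConjecture-14310`
(`Summit.FinalStateConjecture.FinalStateConjecture.Theses.ClusterCompleteness.AdiabaticMultiKerrILED`),
line `Sketch`, stub `multiplierBulk_radial_tailsCut` (lead c7, wave 4, Morawetz bricks).

Setting (one zone, zero spin, rest frame): the coefficient field is the tails-cut Kerr–Schild field
`G₀ = η⁻¹ − μ ℓ♯ ⊗ ℓ♯ = KerrSchild.inverseMetric μ (Kerr.nullVector 0)` with the profile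
`μ(y) = χ(r) · 2H = m(r)`, `m(s) = χ(2 − s/(8M)) · 2M/s` (`χ = Real.smoothTransition`, `r = ‖y⃗‖`,
`H = M/r`, `ℓ♯ = (−1, y⃗/r)`), i.e. `G₀^{00} = −1 − m`, `G₀^{0i} = (m/r) yⁱ`,
`G₀^{ij} = δ^{ij} − (m/r²) yⁱ yʲ`: the static metric `g = −f dT² + dr²/f + r² dΩ²`, `f = 1 − m`, in
ingoing coordinates. The multiplier is `X = F(r) ∂_{r*}`, `∂_{r*} = f (y⃗/r)·∇ + m ∂₀`, with
components `X⁰ = F m`, `Xⁱ = F f yⁱ/r`.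

* `radialBulk_generic` — **the bulk term `K^X` of `KerrSchild.multiplierBulk` for a general
  stationary, spherically symmetric field of this shape** (`G^{00} = −1 − A(r)`, `G^{0i} = B(r) yⁱ`,
  `G^{ij} = δ − C(r) yⁱyʲ`, `X⁰ = D(r)`, `Xⁱ = E(r) yⁱ`, any radial function `r` with
  `∂₀ r = 0`, `∂ᵢ r = ρ yⁱ`), by brute-force expansion of the three groups of `multiplierBulk`
  (the coordinate derivatives of the components are `radialBulk_fderiv_X/G`);
* `multiplierBulk_radial_tailsCut` — **the registered stub**: specialising to `A = m`, `B = m/r`,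
  `C = m/r²`, `D = F m`, `E = F f/r`, `ρ = 1/r`, the bulk is Dafermos–Rodnianski's
  `K^X = F_r (∂_{r*}ψ)² + (F/r)(f − r f_r/2) |∇̸ψ|² − ½ (f F_r + 2 f F/r) G₀(dψ, dψ)`
  (arXiv:0811.0354, §4.1.1), with `∂_{r*}ψ = f (y⃗·∇ψ)/r + m ∂₀ψ`,
  `|∇̸ψ|² = |∇ψ|² − ((y⃗·∇ψ)/r)²`.

Dafermos–Rodnianski, *Lectures on black holes and linear waves*, arXiv:0811.0354, §4.1.1 (the
`X`-estimate on Schwarzschild); Dafermos–Rodnianski–Shlapentokh-Rothman arXiv:1402.7034, §2.3.1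
(`K^X = T_{μν} ∇^μ X^ν`). [folklore]
-/

noncomputable section

-- the doubled `FinalStateConjecture.FinalStateConjecture` path component trips dupNamespace
set_option linter.dupNamespace false

open scoped BigOperators Topology
open Literature.Geometry.Lorentzian

namespace Summit.FinalStateConjecture.FinalStateConjecture.Theorems

/-! ### Coordinate derivatives of radial functions times coordinates -/

/-- Chain rule: for a radial function `r = R(y)` with `∂_μ r = (0, ρ y¹, ρ y², ρ y³)` at `x` and
`Φ` with derivative `φ'` at `R x`, `∂_μ [Φ(r)] = φ' ∂_μ r`. [folklore] -/
theorem radialBulk_fderiv_comp {R : E4 → ℝ} {ρ : ℝ} {x : E4} {Φ : ℝ → ℝ} {φ' : ℝ}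
    (hR : DifferentiableAt ℝ R x)
    (hdR : ∀ μ, fderiv ℝ R x (E4.basisVector μ) = if μ = 0 then 0 else ρ * x μ)
    (hΦ : HasDerivAt Φ φ' (R x)) (μ : Fin 4) :
    fderiv ℝ (fun y ↦ Φ (R y)) x (E4.basisVector μ) = φ' * (if μ = 0 then 0 else ρ * x μ) := by
  have h : HasFDerivAt (fun y ↦ Φ (R y)) (φ' • fderiv ℝ R x) x :=
    hΦ.comp_hasFDerivAt x hR.hasFDerivAt
  rw [h.fderiv, smul_apply, smul_eq_mul, hdR]

/-- Leibniz rule: `∂_μ [Φ(r) y^α] = φ' (∂_μ r) y^α + Φ(r) δ^α_μ`. [folklore] -/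
theorem radialBulk_fderiv_comp_mul {R : E4 → ℝ} {ρ : ℝ} {x : E4} {Φ : ℝ → ℝ} {φ' : ℝ}
    (hR : DifferentiableAt ℝ R x)
    (hdR : ∀ μ, fderiv ℝ R x (E4.basisVector μ) = if μ = 0 then 0 else ρ * x μ)
    (hΦ : HasDerivAt Φ φ' (R x)) (α μ : Fin 4) :
    fderiv ℝ (fun y ↦ Φ (R y) * y α) x (E4.basisVector μ) =
      φ' * (if μ = 0 then 0 else ρ * x μ) * x α + Φ (R x) * (if α = μ then 1 else 0) := by
  have h : HasFDerivAt (fun y ↦ Φ (R y) * y α)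
      (Φ (R x) • E4.dx α + x α • (φ' • fderiv ℝ R x)) x :=
    (hΦ.comp_hasFDerivAt x hR.hasFDerivAt).mul (KerrSchild.hasFDerivAt_coord α x)
  rw [h.fderiv]
  simp only [add_apply, smul_apply, smul_eq_mul, hdR,
    Kerr.dx_basisVector]
  ring

/-- Leibniz rule: `∂_μ [Φ(r) y^α y^β] = φ' (∂_μ r) y^α y^β + Φ(r) (δ^α_μ y^β + y^α δ^β_μ)`.
[folklore] -/
theorem radialBulk_fderiv_comp_mul_mul {R : E4 → ℝ} {ρ : ℝ} {x : E4} {Φ : ℝ → ℝ} {φ' : ℝ}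
    (hR : DifferentiableAt ℝ R x)
    (hdR : ∀ μ, fderiv ℝ R x (E4.basisVector μ) = if μ = 0 then 0 else ρ * x μ)
    (hΦ : HasDerivAt Φ φ' (R x)) (α β μ : Fin 4) :
    fderiv ℝ (fun y ↦ Φ (R y) * y α * y β) x (E4.basisVector μ) =
      φ' * (if μ = 0 then 0 else ρ * x μ) * x α * x β +
        Φ (R x) * ((if α = μ then 1 else 0) * x β + x α * (if β = μ then 1 else 0)) := by
  have h : HasFDerivAt (fun y ↦ Φ (R y) * y α * y β)
      ((Φ (R x) * x α) • E4.dx β + x β • (Φ (R x) • E4.dx α + x α • (φ' • fderiv ℝ R x))) x :=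
    ((hΦ.comp_hasFDerivAt x hR.hasFDerivAt).mul (KerrSchild.hasFDerivAt_coord α x)).mul
      (KerrSchild.hasFDerivAt_coord β x)
  rw [h.fderiv]
  simp only [add_apply, smul_apply, smul_eq_mul, hdR,
    Kerr.dx_basisVector]
  ring

/-- **Coordinate derivatives of the radial multiplier** `X⁰ = D(r)`, `X^β = E(r) y^β` (`β ≠ 0`):
`∂_μ X⁰ = D' ∂_μ r`, `∂_μ X^β = E' (∂_μ r) y^β + E δ^β_μ`. [folklore] -/
theorem radialBulk_fderiv_X {R : E4 → ℝ} {ρ : ℝ} {x : E4} {D E : ℝ → ℝ} {d' e' : ℝ}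
    (hR : DifferentiableAt ℝ R x)
    (hdR : ∀ μ, fderiv ℝ R x (E4.basisVector μ) = if μ = 0 then 0 else ρ * x μ)
    (hD : HasDerivAt D d' (R x)) (hE : HasDerivAt E e' (R x)) (β μ : Fin 4) :
    fderiv ℝ (fun y ↦ if β = 0 then D (R y) else E (R y) * y β) x (E4.basisVector μ) =
      if β = 0 then d' * (if μ = 0 then 0 else ρ * x μ)
      else e' * (if μ = 0 then 0 else ρ * x μ) * x β + E (R x) * (if β = μ then 1 else 0) := by
  by_cases hβ : β = 0
  · simp only [hβ, if_true]
    exact radialBulk_fderiv_comp hR hdR hD μ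
  · simp only [hβ, if_false]
    exact radialBulk_fderiv_comp_mul hR hdR hE β μ

/-- **Coordinate derivatives of the field** `G^{00} = −1 − A(r)`, `G^{0β} = G^{β0} = B(r) y^β`,
`G^{αβ} = δ^{αβ} − C(r) y^α y^β` (`α, β ≠ 0`). [folklore] -/
theorem radialBulk_fderiv_G {R : E4 → ℝ} {ρ : ℝ} {x : E4} {A B C : ℝ → ℝ} {a' b' c' : ℝ}
    (hR : DifferentiableAt ℝ R x)
    (hdR : ∀ μ, fderiv ℝ R x (E4.basisVector μ) = if μ = 0 then 0 else ρ * x μ)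
    (hA : HasDerivAt A a' (R x)) (hB : HasDerivAt B b' (R x)) (hC : HasDerivAt C c' (R x))
    (α β μ : Fin 4) :
    fderiv ℝ (fun y ↦ if α = 0 then (if β = 0 then -1 - A (R y) else B (R y) * y β)
        else (if β = 0 then B (R y) * y α
          else (if α = β then 1 else 0) - C (R y) * y α * y β)) x (E4.basisVector μ) =
      if α = 0 then
        (if β = 0 then -(a' * (if μ = 0 then 0 else ρ * x μ))
          else b' * (if μ = 0 then 0 else ρ * x μ) * x β + B (R x) * (if β = μ then 1 else 0))
      else
        (if β = 0 then b' * (if μ = 0 then 0 else ρ * x μ) * x α + B (R x) * (if α = μ then 1 else 0)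
          else -(c' * (if μ = 0 then 0 else ρ * x μ) * x α * x β +
            C (R x) * ((if α = μ then 1 else 0) * x β + x α * (if β = μ then 1 else 0)))) := by
  by_cases hα : α = 0 <;> by_cases hβ : β = 0 <;> simp only [hα, hβ, if_true, if_false]
  · rw [fderiv_const_sub, neg_apply, radialBulk_fderiv_comp hR hdR hA μ]
  · exact radialBulk_fderiv_comp_mul hR hdR hB β μ
  · exact radialBulk_fderiv_comp_mul hR hdR hB α μ
  · rw [fderiv_const_sub, neg_apply,
      radialBulk_fderiv_comp_mul_mul hR hdR hC α β μ]

/-! ### The bulk of a radial multiplier for a stationary spherically symmetric field -/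

/-- **The bulk term `K^X` for a stationary, spherically symmetric Kerr–Schild-type field and a radial
multiplier.** For a radial function `r = R(y)` differentiable at `x` with
`∂_μ r (x) = (0, ρ x¹, ρ x², ρ x³)`, functions `A, …, E` with derivatives `a', …, e'` at `R x`, the
field `G^{00} = −1 − A(r)`, `G^{0i} = G^{i0} = B(r) yⁱ`, `G^{ij} = δ^{ij} − C(r) yⁱ yʲ` and the
multiplier `X⁰ = D(r)`, `Xⁱ = E(r) yⁱ`, with `p_μ = ∂_μw(x)`, `Y = y⃗·p⃗`, `Π = |p⃗|²`, `S = |y⃗|²`,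
`u = B p₀ − C Y`, `v = d' p₀ + e' Y`, `Q = (−1 − A) p₀² + 2 B Y p₀ + Π − C Y²`:
`K^X = u ρ v S + u E Y + ρ v Y + E Π − ½ (e' ρ S + 3E) Q
  − ½ E (ρ S (−a' p₀² + 2 b' p₀ Y − c' Y²) + Y (2 B p₀ − 2 C Y))`
(the three groups `∑ A^μ ∂_μX^β p_β`, `−½ (div X) Q`, `−½ X^μ (∂_μ G)(p,p)` of
`KerrSchild.multiplierBulk`, expanded). [folklore] -/
theorem radialBulk_generic {R : E4 → ℝ} {ρ : ℝ} {x : E4} {A B C D E : ℝ → ℝ}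
    {a' b' c' d' e' : ℝ} (w : E4 → ℝ) (p : Fin 4 → ℝ)
    (hp : ∀ κ, fderiv ℝ w x (E4.basisVector κ) = p κ)
    (hR : DifferentiableAt ℝ R x)
    (hdR : ∀ μ, fderiv ℝ R x (E4.basisVector μ) = if μ = 0 then 0 else ρ * x μ)
    (hA : HasDerivAt A a' (R x)) (hB : HasDerivAt B b' (R x)) (hC : HasDerivAt C c' (R x))
    (hD : HasDerivAt D d' (R x)) (hE : HasDerivAt E e' (R x)) :
    KerrSchild.multiplierBulk
        (fun y μ ν ↦ if μ = 0 then (if ν = 0 then -1 - A (R y) else B (R y) * y ν)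
          else (if ν = 0 then B (R y) * y μ
            else (if μ = ν then 1 else 0) - C (R y) * y μ * y ν))
        (fun y α ↦ if α = 0 then D (R y) else E (R y) * y α) w x =
      (B (R x) * p 0 - C (R x) * (∑ i : Fin 3, x i.succ * p i.succ)) * ρ *
            (d' * p 0 + e' * (∑ i : Fin 3, x i.succ * p i.succ)) * E4.spatialNorm x ^ 2 +
          (B (R x) * p 0 - C (R x) * (∑ i : Fin 3, x i.succ * p i.succ)) * E (R x) *
            (∑ i : Fin 3, x i.succ * p i.succ) +
          ρ * (d' * p 0 + e' * (∑ i : Fin 3, x i.succ * p i.succ)) *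
            (∑ i : Fin 3, x i.succ * p i.succ) +
          E (R x) * (∑ i : Fin 3, p i.succ ^ 2) -
        2⁻¹ * (e' * ρ * E4.spatialNorm x ^ 2 + 3 * E (R x)) *
          ((-1 - A (R x)) * p 0 ^ 2 + 2 * B (R x) * (∑ i : Fin 3, x i.succ * p i.succ) * p 0 +
            (∑ i : Fin 3, p i.succ ^ 2) - C (R x) * (∑ i : Fin 3, x i.succ * p i.succ) ^ 2) -
        2⁻¹ * E (R x) *
          (ρ * E4.spatialNorm x ^ 2 * (-(a' * p 0 ^ 2) +
              2 * b' * p 0 * (∑ i : Fin 3, x i.succ * p i.succ) -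
              c' * (∑ i : Fin 3, x i.succ * p i.succ) ^ 2) +
            (∑ i : Fin 3, x i.succ * p i.succ) *
              (2 * B (R x) * p 0 - 2 * C (R x) * (∑ i : Fin 3, x i.succ * p i.succ))) := by
  simp only [KerrSchild.multiplierBulk, radialBulk_fderiv_X hR hdR hD hE,
    radialBulk_fderiv_G hR hdR hA hB hC, hp]
  rw [E4.spatialNorm_sq]
  have h3 : (2 : Fin 3).succ = (3 : Fin 4) := rfl
  simp only [Fin.sum_univ_four, Fin.sum_univ_three, Fin.isValue, Fin.succ_zero_eq_one,
    Fin.succ_one_eq_two, h3]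
  simp only [show (1 : Fin 4) ≠ 0 from by decide, show (2 : Fin 4) ≠ 0 from by decide,
    show (3 : Fin 4) ≠ 0 from by decide, show (0 : Fin 4) ≠ 1 from by decide,
    show (0 : Fin 4) ≠ 2 from by decide, show (0 : Fin 4) ≠ 3 from by decide,
    show (1 : Fin 4) ≠ 2 from by decide, show (1 : Fin 4) ≠ 3 from by decide,
    show (2 : Fin 4) ≠ 1 from by decide, show (2 : Fin 4) ≠ 3 from by decide,
    show (3 : Fin 4) ≠ 1 from by decide, show (3 : Fin 4) ≠ 2 from by decide, if_true, if_false,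
    mul_zero, zero_mul, add_zero, zero_add, mul_one, one_mul, neg_zero]
  ring

/-! ### The zero-spin Kerr–Schild data as functions of the radius -/

/-- For `a = 0`, `H = M/r` at every point (`H = M r³/r⁴`; both sides vanish at `r = 0`).
Visser arXiv:0706.0622, (33). [folklore] -/
theorem radialBulk_scalarH_zero (M : ℝ) (y : E4) : Kerr.scalarH M 0 y = M / Kerr.radius 0 y := by
  unfold Kerr.scalarH
  have h0 : (0 : ℝ) ^ 2 * y 3 ^ 2 = 0 := by ring
  rw [h0, add_zero]
  rcases eq_or_ne (Kerr.radius 0 y) 0 with h | h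
  · simp [h]
  · rw [div_eq_div_iff (pow_ne_zero 4 h) h]
    ring

/-- For `a = 0`, the spatial components of `ℓ♯` are `yⁱ/r` at every point (both sides vanish at
`r = 0`). Visser arXiv:0706.0622, (34). [folklore] -/
theorem radialBulk_nullVector_succ (y : E4) (i : Fin 3) :
    Kerr.nullVector 0 y i.succ = y i.succ / Kerr.radius 0 y := by
  have hq : Kerr.radius 0 y ^ 2 + (0 : ℝ) ^ 2 = Kerr.radius 0 y ^ 2 := by ring
  fin_cases i
  · show Kerr.nullVector 0 y 1 = y 1 / Kerr.radius 0 y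
    rw [Kerr.nullVector_apply_one, Kerr.nullCovectorFun_apply_one, hq, zero_mul, add_zero]
    rcases eq_or_ne (Kerr.radius 0 y) 0 with h | h
    · simp [h]
    · rw [div_eq_div_iff (pow_ne_zero 2 h) h]
      ring
  · show Kerr.nullVector 0 y 2 = y 2 / Kerr.radius 0 y
    rw [Kerr.nullVector_apply_two, Kerr.nullCovectorFun_apply_two, hq, zero_mul, sub_zero]
    rcases eq_or_ne (Kerr.radius 0 y) 0 with h | h
    · simp [h]
    · rw [div_eq_div_iff (pow_ne_zero 2 h) h]
      ring
  · show Kerr.nullVector 0 y 3 = y 3 / Kerr.radius 0 y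
    rw [Kerr.nullVector_apply_three, Kerr.nullCovectorFun_apply_three]

/-- For `a = 0`, `∂_μ r = (0, x¹/r, x²/r, x³/r)` wherever `r > 0` (`Σ = r²`, `∇r = x⃗/r`).
Visser arXiv:0706.0622, (35). [folklore] -/
theorem radialBulk_fderiv_radius_zero {x : E4} (hx : 0 < Kerr.radius 0 x) (μ : Fin 4) :
    fderiv ℝ (Kerr.radius 0) x (E4.basisVector μ) =
      if μ = 0 then 0 else (Kerr.radius 0 x)⁻¹ * x μ := by
  have hr0 : Kerr.radius 0 x ≠ 0 := hx.ne'
  refine Fin.cases ?_ (fun i ↦ ?_) μ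
  · rw [Kerr.fderiv_radius_basisVector_zero 0 hx]
    simp
  · rw [Kerr.fderiv_radius_basisVector_succ hx i, Kerr.blSigma_spatial_eq, ← Kerr.radius_zero_left]
    simp only [Fin.succ_ne_zero, if_false]
    have h0 : (if i = 2 then (0 : ℝ) ^ 2 * x 3 else 0) = 0 := by split_ifs <;> ring
    have h1 : 2 * Kerr.radius 0 x ^ 2 - Kerr.radius 0 x ^ 2 + (0 : ℝ) ^ 2 = Kerr.radius 0 x ^ 2 := by
      ring
    rw [h0, h1, add_zero, inv_mul_eq_div, div_eq_div_iff (by positivity) hr0]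
    ring

/-! ### The registered stub -/

/-- **The bulk of the radial Morawetz multiplier on the tails-cut Schwarzschild zone**
(Dafermos–Rodnianski arXiv:0811.0354, §4.1.1). For `M > 0`, a point `x` with `r = r(x) > 0`
(`r = Kerr.radius 0 x = ‖x⃗‖`), `F` differentiable at `r`, the tails-cut field
`G₀ = η⁻¹ − μ ℓ♯ ⊗ ℓ♯`, `μ = χ(2 − r/8M) · 2H = m(r)`, `f = 1 − m`, and the multiplier
`X = F(r) ∂_{r*}` (`X⁰ = F μ`, `Xⁱ = F (1 − μ) xⁱ/r`):
`K^X = F_r (∂_{r*}ψ)² + (F/r)(f − r f_r/2) |∇̸ψ|² − ½ (f F_r + 2 f F/r) G₀(dψ, dψ)` with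
`∂_{r*}ψ = f (x⃗·∇ψ)/r + μ ∂₀ψ`, `|∇̸ψ|² = |∇ψ|² − ((x⃗·∇ψ)/r)²`. Proof: `G₀` and `X` are of the
shape of `radialBulk_generic` with `A = m`, `B = m/r`, `C = m/r²`, `D = F m`, `E = F f/r`,
`ρ = 1/r` (`radialBulk_scalarH_zero`, `radialBulk_nullVector_succ`,
`radialBulk_fderiv_radius_zero`), and the resulting rational identity in
`r, F, F_r, m, m_r, ∂ψ, x⃗` closes by `field_simp; ring`. [folklore] -/
theorem multiplierBulk_radial_tailsCut : ∀ (M : ℝ) (F : ℝ → ℝ) (ψ : E4 → ℝ) (x : E4), 0 < M → 0 < Kerr.radius 0 x → DifferentiableAt ℝ F (Kerr.radius 0 x) → KerrSchild.multiplierBulk (KerrSchild.inverseMetric (fun y ↦ Real.smoothTransition (2 - Kerr.radius 0 y / (8 * M)) * (2 * Kerr.scalarH M 0 y)) (Kerr.nullVector 0)) (fun (z : E4) (α : Fin 4) ↦ if α = 0 then F (Kerr.radius 0 z) * (Real.smoothTransition (2 - Kerr.radius 0 z / (8 * M)) * (2 * Kerr.scalarH M 0 z)) else F (Kerr.radius 0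 z) * (1 - Real.smoothTransition (2 - Kerr.radius 0 z / (8 * M)) * (2 * Kerr.scalarH M 0 z)) * z α / Kerr.radius 0 z) ψ x = deriv F (Kerr.radius 0 x) * ((1 - (Real.smoothTransition (2 - Kerr.radius 0 x / (8 * M)) * (2 * Kerr.scalarH M 0 x))) * (∑ i : Fin 3, x i.succ * fderiv ℝ ψ x (E4.basisVector i.succ)) / Kerr.radius 0 x + (Real.smoothTransition (2 - Kerr.radius 0 x / (8 * M)) * (2 * Kerr.scalarH M 0 x)) * fderiv ℝ ψ x (E4.basisVector 0)) ^ 2 + F (Kerr.radius 0 x) / Kerr.radius 0 x * ((fun s : ℝ ↦ 1 - Real.smoothTransition (2 - s / (8 * M)) * (2 * M / s)) (Kerr.radius 0 x) - Kerr.radius 0 x * deriv (fun s : ℝ ↦ 1 - Real.smoothTransition (2 - s / (8 * M)) * (2 * M / s)) (Kerr.radius 0 x) / 2) * ((∑ i : Fin 3, fderiv ℝ ψ x (E4.basisVector i.succ) ^ 2) - ((∑ i : Fin 3, x i.succ * fderiv ℝ ψ x (E4.basisVector i.succ)) / Kerr.radius 0 x) ^ 2) - 2⁻¹ * ((fun s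 : ℝ ↦ 1 - Real.smoothTransition (2 - s / (8 * M)) * (2 * M / s)) (Kerr.radius 0 x) * deriv F (Kerr.radius 0 x) + 2 * (fun s : ℝ ↦ 1 - Real.smoothTransition (2 - s / (8 * M)) * (2 * M / s)) (Kerr.radius 0 x) * F (Kerr.radius 0 x) / Kerr.radius 0 x) * (∑ μ, ∑ ν, (KerrSchild.inverseMetric (fun y ↦ Real.smoothTransition (2 - Kerr.radius 0 y / (8 * M)) * (2 * Kerr.scalarH M 0 y)) (Kerr.nullVector 0)) x μ ν * fderiv ℝ ψ x (E4.basisVector μ) * fderiv ℝ ψ x (E4.basisVector ν)) := by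
  intro M F ψ x hM hx hF
  have hr0 : Kerr.radius 0 x ≠ 0 := hx.ne'
  -- the profile as a function `m` of the radius
  obtain ⟨m, hm⟩ : ∃ m : ℝ → ℝ, ∀ s, m s = Real.smoothTransition (2 - s / (8 * M)) * (2 * M / s) :=
    ⟨_, fun _ ↦ rfl⟩
  have hprof : ∀ y, Real.smoothTransition (2 - Kerr.radius 0 y / (8 * M)) * (2 * Kerr.scalarH M 0 y) =
      m (Kerr.radius 0 y) := by
    intro y
    rw [hm, radialBulk_scalarH_zero]
    ring
  -- the field and the multiplier in the shape of `radialBulk_generic`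
  have hG : KerrSchild.inverseMetric
        (fun y ↦ Real.smoothTransition (2 - Kerr.radius 0 y / (8 * M)) * (2 * Kerr.scalarH M 0 y))
        (Kerr.nullVector 0) =
      fun y μ ν ↦ if μ = 0 then
          (if ν = 0 then -1 - m (Kerr.radius 0 y) else m (Kerr.radius 0 y) / Kerr.radius 0 y * y ν)
        else (if ν = 0 then m (Kerr.radius 0 y) / Kerr.radius 0 y * y μ
          else (if μ = ν then 1 else 0) -
            m (Kerr.radius 0 y) / (Kerr.radius 0 y * Kerr.radius 0 y) * y μ * y ν) := by
    funext y μ ν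
    simp only [KerrSchild.inverseMetric, Kerr.etaComp, hprof y]
    refine Fin.cases ?_ (fun i ↦ ?_) μ <;> refine Fin.cases ?_ (fun j ↦ ?_) ν <;>
      simp only [Fin.succ_ne_zero, (Fin.succ_ne_zero _).symm, if_true, if_false,
        Kerr.nullVector_apply_zero, radialBulk_nullVector_succ, Fin.succ_inj] <;> ring
  have hX : (fun (z : E4) (α : Fin 4) ↦ if α = 0 then F (Kerr.radius 0 z) *
        (Real.smoothTransition (2 - Kerr.radius 0 z / (8 * M)) * (2 * Kerr.scalarH M 0 z))
        else F (Kerr.radius 0 z) * (1 - Real.smoothTransition (2 - Kerr.radius 0 z / (8 * M)) *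
          (2 * Kerr.scalarH M 0 z)) * z α / Kerr.radius 0 z) =
      fun z α ↦ if α = 0 then F (Kerr.radius 0 z) * m (Kerr.radius 0 z)
        else F (Kerr.radius 0 z) * (1 - m (Kerr.radius 0 z)) / Kerr.radius 0 z * z α := by
    funext z α
    rw [hprof z]
    by_cases hα : α = 0
    · simp only [hα, if_true]
    · simp only [hα, if_false]
      ring
  -- calculus of the radial coefficient functions at `r = r(x)`
  have hRd : DifferentiableAt ℝ (Kerr.radius 0) x :=
    (Kerr.contDiffAt_radius hx (n := 1)).differentiableAt one_ne_zero
  have hmd : DifferentiableAt ℝ m (Kerr.radius 0 x) := by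
    have hfun : m = fun s ↦ Real.smoothTransition (2 - s / (8 * M)) * (2 * M / s) := funext hm
    have h2 : DifferentiableAt ℝ (fun s : ℝ ↦ 2 * M / s) (Kerr.radius 0 x) :=
      (differentiableAt_const (2 * M)).div differentiableAt_id hr0
    rw [hfun]
    exact (zonePumping_differentiable_cutoff M (Kerr.radius 0 x)).mul h2
  have hA : HasDerivAt m (deriv m (Kerr.radius 0 x)) (Kerr.radius 0 x) := hmd.hasDerivAt
  have hFd : HasDerivAt F (deriv F (Kerr.radius 0 x)) (Kerr.radius 0 x) := hF.hasDerivAt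
  have hB : HasDerivAt (fun s ↦ m s / s)
      ((deriv m (Kerr.radius 0 x) * Kerr.radius 0 x - m (Kerr.radius 0 x) * 1) /
        Kerr.radius 0 x ^ 2) (Kerr.radius 0 x) :=
    hA.fun_div (hasDerivAt_id _) hr0
  have hC : HasDerivAt (fun s ↦ m s / (s * s))
      ((deriv m (Kerr.radius 0 x) * (Kerr.radius 0 x * Kerr.radius 0 x) -
          m (Kerr.radius 0 x) * (1 * Kerr.radius 0 x + Kerr.radius 0 x * 1)) /
        (Kerr.radius 0 x * Kerr.radius 0 x) ^ 2) (Kerr.radius 0 x) :=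
    hA.fun_div ((hasDerivAt_id _).fun_mul (hasDerivAt_id _)) (mul_ne_zero hr0 hr0)
  have hD : HasDerivAt (fun s ↦ F s * m s)
      (deriv F (Kerr.radius 0 x) * m (Kerr.radius 0 x) + F (Kerr.radius 0 x) *
        deriv m (Kerr.radius 0 x)) (Kerr.radius 0 x) :=
    hFd.fun_mul hA
  have hE : HasDerivAt (fun s ↦ F s * (1 - m s) / s)
      (((deriv F (Kerr.radius 0 x) * (1 - m (Kerr.radius 0 x)) +
          F (Kerr.radius 0 x) * -deriv m (Kerr.radius 0 x)) * Kerr.radius 0 x -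
          F (Kerr.radius 0 x) * (1 - m (Kerr.radius 0 x)) * 1) / Kerr.radius 0 x ^ 2)
        (Kerr.radius 0 x) :=
    (hFd.fun_mul (hA.const_sub 1)).fun_div (hasDerivAt_id _) hr0
  -- the generic identity, and `f = 1 − m`, `f_r = −m_r`
  have key := radialBulk_generic (R := Kerr.radius 0) (ρ := (Kerr.radius 0 x)⁻¹) (A := m)
    (B := fun s ↦ m s / s) (C := fun s ↦ m s / (s * s)) (D := fun s ↦ F s * m s)
    (E := fun s ↦ F s * (1 - m s) / s) ψ (fun κ ↦ fderiv ℝ ψ x (E4.basisVector κ))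
    (fun _ ↦ rfl) hRd (radialBulk_fderiv_radius_zero hx) hA hB hC hD hE
  have hdf : deriv (fun s : ℝ ↦ 1 - Real.smoothTransition (2 - s / (8 * M)) * (2 * M / s))
      (Kerr.radius 0 x) = -deriv m (Kerr.radius 0 x) := by
    have hfun : (fun s : ℝ ↦ 1 - Real.smoothTransition (2 - s / (8 * M)) * (2 * M / s)) =
        fun s ↦ 1 - m s := by
      funext s
      rw [hm]
    rw [hfun, deriv_const_sub]
  rw [hdf, hG, hX]
  refine key.trans ?_
  simp only [hprof x, ← hm]
  -- expand the remaining finite sums and name the atoms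
  rw [← Kerr.radius_zero_left x]
  have h3 : (2 : Fin 3).succ = (3 : Fin 4) := rfl
  simp only [Fin.sum_univ_four, Fin.sum_univ_three, Fin.isValue, Fin.succ_zero_eq_one,
    Fin.succ_one_eq_two, h3]
  simp only [show (1 : Fin 4) ≠ 0 from by decide, show (2 : Fin 4) ≠ 0 from by decide,
    show (3 : Fin 4) ≠ 0 from by decide, show (1 : Fin 4) ≠ 2 from by decide,
    show (1 : Fin 4) ≠ 3 from by decide, show (2 : Fin 4) ≠ 1 from by decide,
    show (2 : Fin 4) ≠ 3 from by decide, show (3 : Fin 4) ≠ 1 from by decide,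
    show (3 : Fin 4) ≠ 2 from by decide, if_true, if_false]
  obtain ⟨p, hp⟩ : ∃ p : Fin 4 → ℝ, ∀ κ, fderiv ℝ ψ x (E4.basisVector κ) = p κ := ⟨_, fun _ ↦ rfl⟩
  obtain ⟨r, hr⟩ : ∃ r : ℝ, Kerr.radius 0 x = r := ⟨_, rfl⟩
  obtain ⟨mv, hmv⟩ : ∃ mv : ℝ, m r = mv := ⟨_, rfl⟩
  obtain ⟨m', hm'⟩ : ∃ m' : ℝ, deriv m r = m' := ⟨_, rfl⟩
  obtain ⟨Fv, hFv⟩ : ∃ Fv : ℝ, F r = Fv := ⟨_, rfl⟩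
  obtain ⟨F', hF'⟩ : ∃ F' : ℝ, deriv F r = F' := ⟨_, rfl⟩
  rw [hr] at hr0
  simp only [hp, hr, hmv, hm', hFv, hF']
  field_simp
  ring

end Summit.FinalStateConjecture.FinalStateConjecture.Theorems

end
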